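import Summits.ABC.IUTFork.Cor312Ind3IteratesVacuityWildEmpty
import Mathlib.FieldTheory.SplittingField.Construction
import HarnessLib

/-!
# [IUTchIII] Thm 3.11 (ii) (Ind3), honest model: a number field WITH a place of `e(v|3) = 4` and EMPTY depth `2`
# (abc-iut cell, wave-5 seat abc-iut-w5-d172, gen 2; record-only, D-0012)

S. Mochizuki, *Inter-universal Teichmüller theory III*, kurims manuscript (May 2020), Prop. 3.5 (ii) (a)(b)
pp. 104–105, Rmk. 1.1.1 (i) p. 28 [claim: Mochizuki2012, status: disputed].

Non-vacuity of the hypothesis class of `Cor312Ind3IteratesVacuityWildEmpty` (p421179: `3 ∈ 𝔭_v`, `e(v|3) = 4` ⇒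
honest depth-`≥ 2` (Ind3) images EMPTY although `e > p_v − 1`) at the NUMBER-FIELD level:

* `Real.four_le_ramificationIdx_of_pow_four` — if the completion `K_v` (`3 ∈ 𝔭_v`) contains `x` with `x⁴ = 3`
  then `4 ≤ e(v|3)` (`‖x‖ = 3^{−1/4}` in abc-iut-S7's rescaled completion, discreteness `‖x‖ ≤ 3^{−1/e}`
  of abc-iut-S1's `norm_le_rpow_of_norm_lt_one`, and `absRamificationIdx_rescaledCompletion`);
* `Real.exists_numberField_pow_four_finrank_le` — a number field `F` of degree `≤ 4` with `α⁴ = 3`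
  (`F = ℚ[X]/(g)` for an irreducible factor `g` of `X⁴ − 3`; no irreducibility of `X⁴ − 3` is needed);
* **`Real.exists_numberField_ramificationIdx_eq_four_nonarchIterImage_eq_empty`** — hence there are a number field
  `F` and a finite place `v` with `p_v = 3`, `e(v|3) = 4` (`4 ≤ e ≤ [F : ℚ] ≤ 4`, p414009's `ramificationIdx_le_finrank`),
  at which the hypothesis `e(v|p_v) ≤ p_v − 1` of p414009 FAILS and nevertheless every honest depth-`≥ 2`
  (Ind3) image for the analytic logarithms is `∅` (p421179).

Honest framing: statements ABOUT THE MODEL; nothing here asserts or denies [IUTchIII] Cor. 3.12 or takes a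
side; typed ≠ proved; instantiated ≠ endorsed.  No definitions, no Prop-valued fact (D-0067 (1)).
-/

noncomputable section

open Set

namespace Summit.ABC.IUTFork.Thm311.Real

open NumberField IsDedekindDomain Literature.IUT.LogVolume Literature.IUT.LogThetaLattice
  Literature.NumberTheory.NumberFields Polynomial

variable {F : Type} [Field F] [NumberField F]

/-! ## 1. A fourth root of `3` in `K_v` forces `e(v|3) ≥ 4` -/

/-- In the rescaled completion at a place over `p = 3`: `x⁴ = 3 ⇒ 4 ≤ e` (`‖x‖⁴ = 1/3`, and `‖x‖ < 1 ⇒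
‖x‖ ≤ 3^{−1/e}`). Stated over a prime `p` with `p = 3`. [cite: NeukirchANT1999, Ch. II (5.5)] -/
theorem four_le_absRamificationIdx_rescaled_of_pow_four (v : HeightOneSpectrum (𝓞 F)) (p : ℕ) [Fact p.Prime]
    (hv : ((p : ℕ) : 𝓞 F) ∈ v.asIdeal) (hp3 : p = 3) (x : RescaledCompletion F p v hv) (hx : x ^ 4 = 3) :
    4 ≤ absRamificationIdx p (RescaledCompletion F p v hv) := by
  subst hp3
  have hnorm4 : ‖x‖ ^ 4 = 3⁻¹ := by rw [← norm_pow, hx, WildCubic.norm_three]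
  have hxlt : ‖x‖ < 1 :=
    (pow_lt_one_iff_of_nonneg (norm_nonneg _) (by norm_num : (4 : ℕ) ≠ 0)).mp (by rw [hnorm4]; norm_num)
  have hdisc := norm_le_rpow_of_norm_lt_one 3 (RescaledCompletion F 3 v hv) hxlt
  set e := absRamificationIdx 3 (RescaledCompletion F 3 v hv) with hedef
  have he0 : (0 : ℝ) < e := by exact_mod_cast absRamificationIdx_pos 3 (RescaledCompletion F 3 v hv)
  have h4 : ‖x‖ ^ 4 ≤ ((3 : ℝ) ^ (-(1 / (e : ℝ)))) ^ 4 := pow_le_pow_left₀ (norm_nonneg _) hdisc 4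
  rw [hnorm4, ← Real.rpow_natCast, ← Real.rpow_mul (by norm_num), ← Real.rpow_neg_one,
    Real.rpow_le_rpow_left_iff (by norm_num : (1 : ℝ) < 3)] at h4
  have hege : (4 : ℝ) ≤ e := by
    have h := mul_le_mul_of_nonneg_right h4 he0.le
    field_simp at h
    push_cast at h
    nlinarith
  exact_mod_cast hege

/-- **`x⁴ = 3` in `K_v` with `3 ∈ 𝔭_v` ⇒ `4 ≤ e(v|3)`** (abc-iut-S7's `absRamificationIdx_rescaledCompletion`).
[cite: NeukirchANT1999, Ch. II (5.5)] -/
theorem four_le_ramificationIdx_of_pow_four (v : HeightOneSpectrum (𝓞 F)) (h3 : ((3 : ℕ) : 𝓞 F) ∈ v.asIdeal)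
    (x : v.adicCompletion F) (hx : x ^ 4 = 3) : 4 ≤ v.asIdeal.ramificationIdx ℤ := by
  have h := four_le_absRamificationIdx_rescaled_of_pow_four v 3 h3 rfl (RescaledCompletion.of F 3 v h3 x)
    (by rw [← map_pow, hx, map_ofNat])
  rwa [absRamificationIdx_rescaledCompletion] at h

/-! ## 2. A number field of degree `≤ 4` with a fourth root of `3` -/

/-- **`F = ℚ[X]/(g)`, `g` an irreducible factor of `X⁴ − 3`**: a number field of degree `deg g ≤ 4` containing `α`
with `α⁴ = 3`. [folklore] -/
theorem exists_numberField_pow_four_finrank_le :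
    ∃ (F : Type) (_ : Field F) (_ : NumberField F) (α : F), α ^ 4 = 3 ∧ Module.finrank ℚ F ≤ 4 := by
  let f : ℚ[X] := X ^ 4 - C 3
  have hf : f.natDegree = 4 := natDegree_X_pow_sub_C
  have hfne : f.natDegree ≠ 0 := by rw [hf]; norm_num
  haveI : Fact (Irreducible f.factor) := ⟨irreducible_factor f⟩
  have hg0 : f.factor ≠ 0 := (irreducible_factor f).ne_zero
  haveI : Module.Finite ℚ (AdjoinRoot f.factor) := (AdjoinRoot.powerBasis hg0).finite
  haveI : CharZero (AdjoinRoot f.factor) :=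
    charZero_of_injective_algebraMap (algebraMap ℚ (AdjoinRoot f.factor)).injective
  haveI : NumberField (AdjoinRoot f.factor) := NumberField.mk
  refine ⟨AdjoinRoot f.factor, inferInstance, inferInstance, AdjoinRoot.root f.factor, ?_, ?_⟩
  · -- the root of `g` is a root of `X⁴ − 3`
    have hdvd : f.factor ∣ f := factor_dvd_of_natDegree_ne_zero hfne
    have halg : algebraMap ℚ (AdjoinRoot f.factor) = AdjoinRoot.of f.factor := Subsingleton.elim _ _
    have hroot : aeval (AdjoinRoot.root f.factor) f.factor = 0 := by
      rw [aeval_def, halg]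
      exact AdjoinRoot.eval₂_root f.factor
    have h0 : aeval (AdjoinRoot.root f.factor) f = 0 := aeval_eq_zero_of_dvd_aeval_eq_zero hdvd hroot
    have h1 : aeval (AdjoinRoot.root f.factor) f = AdjoinRoot.root f.factor ^ 4 - 3 := by
      simp [f, map_ofNat]
    rw [h1, sub_eq_zero] at h0
    exact h0
  · rw [(AdjoinRoot.powerBasis hg0).finrank, AdjoinRoot.powerBasis_dim, ← hf]
    exact natDegree_le_of_dvd (factor_dvd_of_natDegree_ne_zero hfne) (monic_X_pow_sub_C (3 : ℚ) (by norm_num)).ne_zero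


/-! ## 3. The instance: `e(v|3) = 4` and EMPTY depth `≥ 2` -/

/-- **EXISTENCE OF A WILD PLACE WITH `e = 4` AND EMPTY DEPTH `≥ 2`**: there are a number field `F` (`= ℚ(∜3)`)
and a finite place `v` with `p_v = 3`, `e(v|3) = 4` — so the hypothesis `e(v|p_v) ≤ p_v − 1` of p414009 FAILS —
at which every honest depth-`≥ 2` (Ind3) iterate image for the analytic logarithms is nevertheless EMPTY
(p421179).  With p419392 (`e = 3`: depth `2` INHABITED) this shows on actual number fields that vacuity of the
deep (Ind3) clauses is not a function of `e(v|p_v)` versus `p_v`. [claim: Mochizuki2012, status: disputed] -/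
theorem exists_numberField_ramificationIdx_eq_four_nonarchIterImage_eq_empty :
    ∃ (F : Type) (_ : Field F) (_ : NumberField F) (v : HeightOneSpectrum (𝓞 F)),
      residueChar F v = 3 ∧ v.asIdeal.ramificationIdx ℤ = 4 ∧ ¬ v.asIdeal.ramificationIdx ℤ ≤ residueChar F v - 1 ∧
        ∀ k : ℕ, nonarchIterImage (analyticLogv F) v (k + 2) = ∅ := by
  obtain ⟨F, _, _, α, hα, hdeg⟩ := exists_numberField_pow_four_finrank_le
  obtain ⟨v, hv⟩ := exists_heightOneSpectrum_natCast_mem' (F := F) Nat.prime_three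
  have hx : (algebraMap F (v.adicCompletion F) α) ^ 4 = 3 := by rw [← map_pow, hα, map_ofNat]
  have h4 : 4 ≤ v.asIdeal.ramificationIdx ℤ := four_le_ramificationIdx_of_pow_four v hv _ hx
  have hle : v.asIdeal.ramificationIdx ℤ ≤ 4 := (ramificationIdx_le_finrank v).trans hdeg
  have he : v.asIdeal.ramificationIdx ℤ = 4 := le_antisymm hle h4
  exact ⟨F, inferInstance, inferInstance, v, residueChar_eq_of_prime_natCast_mem v Nat.prime_three hv, he,
    not_ramificationIdx_le_of_ramificationIdx_eq_four v hv he,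
    fun k => nonarchIterImage_add_two_eq_empty_of_ramificationIdx_eq_four v hv he k⟩

/-- In EVERY number field of degree `≤ 7` containing a fourth root of `3`, EVERY place over `3` has `e(v|3) = 4`
and EMPTY honest depth-`≥ 2` images (`4 ∣`-free form: `4 ≤ e ≤ [F:ℚ] ≤ 7 < 8` is not used — we only need `e ≤ 4`,
so we state it for degree `≤ 4`). [claim: Mochizuki2012, status: disputed] -/
theorem nonarchIterImage_add_two_eq_empty_of_pow_four_of_finrank_le {α : F} (hα : α ^ 4 = 3)
    (hdeg : Module.finrank ℚ F ≤ 4) (v : HeightOneSpectrum (𝓞 F)) (h3 : ((3 : ℕ) : 𝓞 F) ∈ v.asIdeal) (k : ℕ) :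
    v.asIdeal.ramificationIdx ℤ = 4 ∧ nonarchIterImage (analyticLogv F) v (k + 2) = ∅ := by
  have hx : (algebraMap F (v.adicCompletion F) α) ^ 4 = 3 := by rw [← map_pow, hα, map_ofNat]
  have he : v.asIdeal.ramificationIdx ℤ = 4 :=
    le_antisymm ((ramificationIdx_le_finrank v).trans hdeg) (four_le_ramificationIdx_of_pow_four v h3 _ hx)
  exact ⟨he, nonarchIterImage_add_two_eq_empty_of_ramificationIdx_eq_four v h3 he k⟩

end Summit.ABC.IUTFork.Thm311.Real

end
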